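/-
Copyright (c) 2026 the pub-hodgecm-mathlib formalisation cell (harness21).  Prover seat hodgecm-mathlib-K2E5-p16 (g6), Track B «K2-LIT»,
#184♮ = hLiu418 = `stmt-HodgeConjecture-24832`; organ S2-J (LEAD F0P6-plan (g14) BATCH #20 (1): (J2⊗-arch) `tensorEmb (placeSec_𝔻 σ h) = placeSec_𝕎 σ (h ⊗̃ 1)`),
FILE 1 `K2LiuArchTensorPlaceSecMatrix`: the MATRIX identities behind the group statement — the place sign vector of the tensor datum is the
product, the `√|·|`-scaling is multiplicative, and the scaled conjugate of `reindex e (M ⊗ₖ 1)` is `reindex e (scaleConj M ⊗ₖ 1)` (so its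
sign-frame blocks are ★ J0-b's).  THEOREMS ONLY (no `def`, no `instance`, no notation, no `sorry`).
-/
import Summits.HodgeConjecture.HodgeConjecture.Theorems.K2LiuArchTensorSignFrames   -- ★ J0-b (this seat)
import Literature.NumberTheory.Weil1964.ArchFollandDualPairDefinitePlace        -- ★ `det_scaleConj`
import HarnessLib

/-!
# Crux `HLiu418`, organ S2-J, (J2⊗-arch) FILE 1: matrix identities for `h ⊗̃ 1` in the place sign frames

Cell `hodgecm-mathlib`, crux item hLiu418 = `stmt-HodgeConjecture-24832` (helper lane `--supports`, count-neutral).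

With `J^{𝔻⊗V′} = reindex epsD (J^𝔻 ⊗ₖ diag dV′)` (★ `K2Lit.DoubledTensorEmbedding.hermD_tensor`) the diagonal of the big datum is
`t′_{e(x,k)} = t_x · d_k`, so at a real place `σ`:
* `placeSignVec_tensor`: `placeSignVec t′ c σ (e(x,k)) = placeSignVec t c σ x · σ(d_k)` (★ `placeSignVec` = `σ(t_i)∕c_σ`) — the hypothesis
  `hz` of ★ J0-b's adapter lemmas, with `y = σ ∘ d`;
* `sqrtAbs_tensor`: `√|z_{e(x,k)}| = √|x_x| · √|y_k|`;
* `scaleConj_reindex_kronecker_one`: for scalings `D_{e(a,b)} = D¹_a · D²_b` (`D² ≠ 0`),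
  `scaleConj D (reindex e e (M ⊗ₖ 1)) = reindex e e (scaleConj D¹ M ⊗ₖ 1)` (★ `scaleConj` = `D_i K_{ij} D_j⁻¹`);
* `scaleConj_blockDiagonal`: `scaleConj` preserves block-diagonality in the sign frame of `x`.
Hence the matrix of `toUFormEquiv⁻¹`-type frames of `h ⊗ 1` is `reindex e (scaleConj (sqrtAbs x) M ⊗ₖ 1)`, whose `PosIdx z`∕`NegIdx z` blocks and
determinants are ★ J0-b `submatrix_pos∕negIdx_kronecker_one(_of_eq)`, `det_…_of_eq` — FILE 2 wraps this as `tensorEmb (placeSec_𝔻 σ h) = placeSec_𝕎 σ (h ⊗̃ 1)`.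
References: [Kudla1994, §2]; [KonnoKonno2007, §3.1]; [HarrisKudlaSweet1996, §1 (1.8)].
HONEST LABEL: HC_CM is proved only modulo the 7 printed citations (2 remaining named inputs: hLiu418 = stmt-HodgeConjecture-24832,
h413 = stmt-HodgeConjecture-24833) until rung 0 closes; count-neutral helper, closes no socket.
-/

set_option autoImplicit false
set_option linter.dupNamespace false

noncomputable section

open Matrix
open scoped Kronecker

namespace Summit.HodgeConjecture.HodgeConjecture.Cruxes.HLiu418.K2LiuArchTensorPlaceSecMatrix

open Literature.NumberTheory.Weil1964 (PosIdx NegIdx placeSignVec sqrtAbs scaleConj scaleConj_apply)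
open NumberField NumberField.InfinitePlace

variable {N M n : ℕ}

/-- **THE PLACE SIGN VECTOR OF THE TENSOR DATUM IS THE PRODUCT**: `placeSignVec t′ c σ (e(x,k)) = placeSignVec t c σ x · σ(d_k)` for
`t′_{e(x,k)} = t_x · d_k`. [cite: Kudla1994, §2; KonnoKonno2007, §3.1] -/
theorem placeSignVec_tensor {F : Type} [Field F] (t : Fin N → F) (d : Fin M → F) (e : Fin N × Fin M ≃ Fin n)
    (cV : {v : InfinitePlace F // v.IsReal} → ℝ) (σ : {v : InfinitePlace F // v.IsReal}) (k : Fin n) :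
    placeSignVec (fun j => t (e.symm j).1 * d (e.symm j).2) cV σ k =
      placeSignVec t cV σ (e.symm k).1 * embedding_of_isReal σ.2 (d (e.symm k).2) := by
  simp only [placeSignVec, map_mul]
  ring

/-- **`√|·|` IS MULTIPLICATIVE ON THE TENSOR SIGN VECTOR**: `√|z_j| = √|x_{(e⁻¹j)₁}| · √|y_{(e⁻¹j)₂}|`. [folklore] -/
theorem sqrtAbs_tensor (x : Fin N → ℝ) (y : Fin M → ℝ) (e : Fin N × Fin M ≃ Fin n) (z : Fin n → ℝ)
    (hz : ∀ k, z k = x (e.symm k).1 * y (e.symm k).2) (k : Fin n) :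
    sqrtAbs z k = sqrtAbs x (e.symm k).1 * Real.sqrt |y (e.symm k).2| := by
  simp only [sqrtAbs, hz, abs_mul, Real.sqrt_mul (abs_nonneg _)]

/-- **SCALED CONJUGATION COMMUTES WITH `· ⊗ₖ 1`**: for `D_{e(a,b)} = D¹_a · D²_b` with `D² ≠ 0`,
`scaleConj D (reindex e e (M ⊗ₖ 1)) = reindex e e (scaleConj D¹ M ⊗ₖ 1)`. [folklore] -/
theorem scaleConj_reindex_kronecker_one (D₁ : Fin N → ℝ) (D₂ : Fin M → ℝ) (hD₂ : ∀ j, D₂ j ≠ 0) (e : Fin N × Fin M ≃ Fin n)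
    (D : Fin n → ℝ) (hD : ∀ k, D k = D₁ (e.symm k).1 * D₂ (e.symm k).2) (K : Matrix (Fin N) (Fin N) ℂ) :
    scaleConj D (Matrix.reindex e e (K ⊗ₖ (1 : Matrix (Fin M) (Fin M) ℂ))) =
      Matrix.reindex e e (scaleConj D₁ K ⊗ₖ (1 : Matrix (Fin M) (Fin M) ℂ)) := by
  ext k k'
  rw [scaleConj_apply, Matrix.reindex_apply, Matrix.submatrix_apply, Matrix.kroneckerMap_apply, Matrix.reindex_apply, Matrix.submatrix_apply,
    Matrix.kroneckerMap_apply, scaleConj_apply, hD k, hD k']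
  by_cases hb : (e.symm k).2 = (e.symm k').2
  · rw [hb, Matrix.one_apply_eq]
    have h2 : ((D₂ (e.symm k').2 : ℝ) : ℂ) ≠ 0 := Complex.ofReal_ne_zero.2 (hD₂ _)
    push_cast
    field_simp
  · rw [Matrix.one_apply_ne hb, mul_zero, mul_zero, zero_mul, mul_zero]


/-- **`scaleConj` PRESERVES BLOCK-DIAGONALITY** in the sign frame of `x`. [folklore] -/
theorem scaleConj_blockDiagonal (x : Fin N → ℝ) (D₁ : Fin N → ℝ) (K : Matrix (Fin N) (Fin N) ℂ)
    (hh : ∀ a a', (0 < x a ↔ ¬0 < x a') → K a a' = 0) (a a' : Fin N) (haa : 0 < x a ↔ ¬0 < x a') :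
    scaleConj D₁ K a a' = 0 := by
  rw [scaleConj_apply, hh a a' haa, mul_zero, zero_mul]

/-- **THE `𝕎⁻`-DETERMINANT OF THE SCALED TENSOR ELEMENT**: for `K` block-diagonal in the sign frame of `x` and scalings as above,
`det ((scaleConj D (reindex e e (K ⊗ₖ 1)))|_{NegIdx z}) = det(K⁺)^{|NegIdx y|} · det(K⁻)^{|PosIdx y|}` (`det scaleConj = det`, ★ J0-b).
[cite: KonnoKonno2007, Lemma 5.2] -/
theorem det_submatrix_negIdx_scaleConj_kronecker_one (x : Fin N → ℝ) (y : Fin M → ℝ) (e : Fin N × Fin M ≃ Fin n) (hx : ∀ i, x i ≠ 0)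
    (hy : ∀ j, y j ≠ 0) (z : Fin n → ℝ) (hz : ∀ k, z k = x (e.symm k).1 * y (e.symm k).2)
    (D₁ : Fin N → ℝ) (hD₁ : ∀ i, D₁ i ≠ 0) (D₂ : Fin M → ℝ) (hD₂ : ∀ j, D₂ j ≠ 0) (D : Fin n → ℝ)
    (hD : ∀ k, D k = D₁ (e.symm k).1 * D₂ (e.symm k).2) (K : Matrix (Fin N) (Fin N) ℂ) (hh : ∀ a a', (0 < x a ↔ ¬0 < x a') → K a a' = 0) :
    ((scaleConj D (Matrix.reindex e e (K ⊗ₖ (1 : Matrix (Fin M) (Fin M) ℂ)))).submatrix (Subtype.val : NegIdx z → Fin n) Subtype.val).det =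
      (K.submatrix (Subtype.val : PosIdx x → Fin N) Subtype.val).det ^ Fintype.card (NegIdx y) *
        (K.submatrix (Subtype.val : NegIdx x → Fin N) Subtype.val).det ^ Fintype.card (PosIdx y) := by
  rw [scaleConj_reindex_kronecker_one D₁ D₂ hD₂ e D hD K,
    K2LiuArchTensorSignFrames.det_submatrix_negIdx_kronecker_one_of_eq x y e hx hy z hz (scaleConj D₁ K)
      (fun a a' haa => scaleConj_blockDiagonal x D₁ K hh a a' haa)]
  -- `det (scaleConj D₁ K)|_{PosIdx x} = det K|_{PosIdx x}`: the restriction of a scaled conjugate is the scaled conjugate of the restriction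
  have hP : (scaleConj D₁ K).submatrix (Subtype.val : PosIdx x → Fin N) Subtype.val =
      scaleConj (fun p : PosIdx x => D₁ p.1) (K.submatrix (Subtype.val : PosIdx x → Fin N) Subtype.val) := by
    ext i j; simp only [Matrix.submatrix_apply, scaleConj_apply]
  have hN : (scaleConj D₁ K).submatrix (Subtype.val : NegIdx x → Fin N) Subtype.val =
      scaleConj (fun p : NegIdx x => D₁ p.1) (K.submatrix (Subtype.val : NegIdx x → Fin N) Subtype.val) := by
    ext i j; simp only [Matrix.submatrix_apply, scaleConj_apply]
  rw [hP, hN, Literature.NumberTheory.Weil1964.det_scaleConj (fun p : PosIdx x => D₁ p.1) (fun p => hD₁ p.1),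
    Literature.NumberTheory.Weil1964.det_scaleConj (fun p : NegIdx x => D₁ p.1) (fun p => hD₁ p.1)]

end Summit.HodgeConjecture.HodgeConjecture.Cruxes.HLiu418.K2LiuArchTensorPlaceSecMatrix

end
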